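import Mathlib
import Summits.KontsevichZagierPeriods.KontsevichZagierPeriods.Theorems.InverseLandauTateFamilyKernelStubLinMoments
import Summits.KontsevichZagierPeriods.KontsevichZagierPeriods.Theorems.InverseLandauTateFamilyKernelStubLinMomentsW

/-!
# Crux `TateFamilyKernel` (stmt-KontsevichZagierPeriods-9130), line `Sketch`: stub `stub_gpMoments`

Step GP1 (MOMENTS) of the graph-pencil class of the lead's skeleton of the crux
`Summit.KontsevichZagierPeriods.KontsevichZagierPeriods.Theses.InverseLandau.TateFamilyKernel`:
the Tate denominator `Q = 1 − ϖ·(u(z₂) + βz₁)` with `u ∈ ℚ[s]` positive on `[0,1]`, `0 < β`,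
`(u + β)·b ≤ 1` on `[0,1]` (variables `z 0 = z₁`, `z 1 = z₂`), and a `ϖ`-free numerator
`P ∈ ℚ[z₁,z₂]`. If the open-square fibre integrals `∫ P/(1 − ϖT)`, `T = u(z₂) + βz₁`, vanish for
all `ϖ ∈ (0,b)`, then `∫ g(T)·P = 0` for EVERY real polynomial test function `g`.

* On the open square `0 ≤ T ≤ 1/b` (`GpMoments.gpT_bounds`: `u > 0`, `βz₁ ≤ β`,
  `(u+β)b ≤ 1`), so for `ϖ ∈ (0,b)` one has `0 ≤ ϖT ≤ ϖ/b < 1` and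
  `P/(1 − ϖT) = Σ_M (P·T^M) ϖ^M` pointwise, with the uniform geometric bound
  `|P·T^M| ≤ K (1/b)^M` (`K = max_{[0,1]²} |P|`).
* Term-wise integration and one-sided uniqueness of power-series coefficients
  (`LinMomentsW.integral_coeff_eq_zero` of the landed file `…StubLinMomentsW`, p143634:
  dominated convergence for series + isolated zeros of the analytic sum) give
  `∫ P·T^M = 0` for all `M` (`GpMoments.moment_eq_zero`).
* Linearity: `g(T)·P = Σ_i g_i (P·T^i)` (`Polynomial.eval_eq_sum_range`), each term integrable
  (continuous on the compact closed square), so `∫ g(T)·P = Σ_i g_i·0 = 0`.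

References: Kontsevich–Zagier 2001, §1.2 (an elementary real-analysis step of one test class of
the period conjecture). Mathlib and the two landed linear-class moment files only (helpers
`LinMoments.continuous_aeval`, `LinMoments.sq_subset_Icc`, `LinMomentsW.integral_coeff_eq_zero`);
no named fact, no new definition. Helpers live in the sub-namespace `GpMoments`.
-/

noncomputable section

open MeasureTheory Set MvPolynomial

namespace Summit.KontsevichZagierPeriods.InverseLandau.TateFamilyKernel.Descent

namespace GpMoments

/-! ### The graph-pencil height `T = u(z₂) + βz₁` on the square -/

/-- `T = u(z₂) + βz₁` is continuous in `z`. [folklore] -/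
theorem continuous_gpT (u : Polynomial ℚ) (β : ℚ) :
    Continuous fun z : Fin 2 → ℝ => Polynomial.aeval (z 1) u + (β : ℝ) * z 0 :=
  ((Polynomial.continuous_aeval u).comp (continuous_apply 1)).add
    (continuous_const.mul (continuous_apply 0))

/-- On the open square, `0 ≤ u(z₂) + βz₁ ≤ 1/b` when `u > 0` on `[0,1]`, `0 < β` and
`(u + β)·b ≤ 1` on `[0,1]` (`0 < b`). [folklore] -/
theorem gpT_bounds {u : Polynomial ℚ} {β : ℚ} {b : ℝ} (hβ : 0 < β) (hb : 0 < b)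
    (hu0 : ∀ s ∈ Icc (0 : ℝ) 1, 0 < Polynomial.aeval s u)
    (hub : ∀ s ∈ Icc (0 : ℝ) 1, (Polynomial.aeval s u + β) * b ≤ 1) {z : Fin 2 → ℝ}
    (hz : z ∈ Set.pi Set.univ (fun _ : Fin 2 => Ioo (0 : ℝ) 1)) :
    0 ≤ Polynomial.aeval (z 1) u + (β : ℝ) * z 0 ∧
      Polynomial.aeval (z 1) u + (β : ℝ) * z 0 ≤ 1 / b := by
  have h0 := (mem_univ_pi.mp hz) 0
  have h1 := (mem_univ_pi.mp hz) 1
  have hz1 : z 1 ∈ Icc (0 : ℝ) 1 := ⟨h1.1.le, h1.2.le⟩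
  have hu := hu0 (z 1) hz1
  have hb1 := hub (z 1) hz1
  have hβ' : (0 : ℝ) < β := by exact_mod_cast hβ
  refine ⟨add_nonneg hu.le (mul_nonneg hβ'.le h0.1.le), ?_⟩
  have hT : Polynomial.aeval (z 1) u + (β : ℝ) * z 0 ≤ Polynomial.aeval (z 1) u + β := by
    have h2 := mul_le_of_le_one_right hβ'.le h0.2.le
    linarith
  rw [le_div_iff₀ hb]
  exact (mul_le_mul_of_nonneg_right hT hb.le).trans hb1

/-! ### Vanishing of the moments `∫ P·T^M` -/

/-- **Moments.** Under the hypotheses of `stub_gpMoments`, every moment `∫_□ P·T^M`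
(`T = u(z₂) + βz₁`) vanishes: on the square `0 ≤ ϖT ≤ ϖ/b < 1` for `ϖ ∈ (0,b)`, so
`P/(1 − ϖT) = Σ_M (P T^M) ϖ^M` with `|P T^M| ≤ K (1/b)^M`, and term-wise integration plus the
one-sided uniqueness of power-series coefficients (`LinMomentsW.integral_coeff_eq_zero`) apply.
[cite: KontsevichZagier2001, §1.2] -/
theorem moment_eq_zero {u : Polynomial ℚ} {β : ℚ} {P : MvPolynomial (Fin 2) ℚ} {b : ℝ}
    (hβ : 0 < β) (hb : 0 < b)
    (hu0 : ∀ s ∈ Icc (0 : ℝ) 1, 0 < Polynomial.aeval s u)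
    (hub : ∀ s ∈ Icc (0 : ℝ) 1, (Polynomial.aeval s u + β) * b ≤ 1)
    (hvan : ∀ ϖ ∈ Ioo 0 b, ∫ z in Set.pi Set.univ (fun _ : Fin 2 => Ioo (0 : ℝ) 1),
      aeval z P / (1 - ϖ * (Polynomial.aeval (z 1) u + β * z 0)) = 0) (M : ℕ) :
    ∫ z in Set.pi Set.univ (fun _ : Fin 2 => Ioo (0 : ℝ) 1),
      aeval z P * (Polynomial.aeval (z 1) u + (β : ℝ) * z 0) ^ M = 0 := by
  -- a uniform bound `K` for `|P|` on the closed square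
  obtain ⟨K, hK⟩ :=
    (isCompact_Icc : IsCompact (Icc (0 : Fin 2 → ℝ) 1)).exists_bound_of_continuousOn
      (LinMoments.continuous_aeval P).continuousOn
  have hR : (0 : ℝ) < 1 / b := one_div_pos.mpr hb
  have hϖR : ∀ ϖ ∈ Ioo 0 b, ϖ * (1 / b) < 1 := fun ϖ hϖ => by
    rw [mul_one_div, div_lt_one hb]
    exact hϖ.2
  refine LinMomentsW.integral_coeff_eq_zero
    (F := fun M z => aeval z P * (Polynomial.aeval (z 1) u + (β : ℝ) * z 0) ^ M)
    (g := fun ϖ z => aeval z P / (1 - ϖ * (Polynomial.aeval (z 1) u + (β : ℝ) * z 0)))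
    (K := K) hR hb (fun M => (LinMoments.continuous_aeval P).mul ((continuous_gpT u β).pow M))
    (fun M z hz => ?_) hϖR (fun ϖ hϖ z hz => ?_) hvan M
  · -- the uniform geometric bound `|P T^M| ≤ K (1/b)^M`
    have hT := gpT_bounds hβ hb hu0 hub hz
    have hPz := hK z (LinMoments.sq_subset_Icc hz)
    rw [Real.norm_eq_abs] at hPz
    rw [abs_mul, abs_pow, abs_of_nonneg hT.1]
    exact mul_le_mul hPz (pow_le_pow_left₀ hT.1 hT.2 M) (pow_nonneg hT.1 M)
      ((abs_nonneg _).trans hPz)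
  · -- the pointwise geometric expansion `P/(1 − ϖT) = Σ_M P T^M ϖ^M`
    have hT := gpT_bounds hβ hb hu0 hub hz
    have hr0 : 0 ≤ ϖ * (Polynomial.aeval (z 1) u + (β : ℝ) * z 0) := mul_nonneg hϖ.1.le hT.1
    have hr1 : ϖ * (Polynomial.aeval (z 1) u + (β : ℝ) * z 0) < 1 :=
      lt_of_le_of_lt (mul_le_mul_of_nonneg_left hT.2 hϖ.1.le) (hϖR ϖ hϖ)
    have h := (hasSum_geometric_of_lt_one hr0 hr1).mul_left (aeval z P)
    have hfun :
        (fun n : ℕ => aeval z P * (Polynomial.aeval (z 1) u + (β : ℝ) * z 0) ^ n * ϖ ^ n) =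
          fun n : ℕ => aeval z P * (ϖ * (Polynomial.aeval (z 1) u + (β : ℝ) * z 0)) ^ n := by
      funext n
      rw [mul_pow ϖ]
      ring
    show HasSum
      (fun n : ℕ => aeval z P * (Polynomial.aeval (z 1) u + (β : ℝ) * z 0) ^ n * ϖ ^ n)
      (aeval z P / (1 - ϖ * (Polynomial.aeval (z 1) u + (β : ℝ) * z 0)))
    rw [hfun, div_eq_mul_inv]
    exact h

end GpMoments

/-- STUB `stub_gpMoments` (graph-pencil class, step GP1: MOMENTS / polynomial test functions). For
`Q = 1 − ϖ(u(z₂) + βz₁)` with `u ∈ ℚ[s]` positive on `[0,1]`, `0 < β`, `(u+β)b ≤ 1` on `[0,1]`,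
and a `ϖ`-free numerator `P` whose open-square fibre integrals `∫_{(0,1)²} P/Q(·,ϖ)` vanish for all
`ϖ ∈ (0,b)`, every polynomial test function of `T = u(z₂) + βz₁` integrates to zero against `P`:
`0 ≤ ϖT ≤ ϖ/b < 1` on the square, the geometric series and dominated convergence expand the fibre
integral as the power series `Σ_M (∫ P T^M) ϖ^M` with coefficients `O(b^{-M})`, a real power
series vanishing on `(0,b)` has all coefficients zero (`GpMoments.moment_eq_zero` via
`LinMomentsW.integral_coeff_eq_zero`, isolated zeros), and `g(T)·P = Σ_i g_i·(P T^i)` is a finite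
sum of integrable terms. [cite: KontsevichZagier2001, §1.2] -/
theorem stub_gpMoments (u : Polynomial ℚ) (β : ℚ) (P : MvPolynomial (Fin 2) ℚ) (b : ℝ) (hβ : 0 < β) (hb : 0 < b)
    (hu0 : ∀ s ∈ Icc (0 : ℝ) 1, 0 < Polynomial.aeval s u)
    (hub : ∀ s ∈ Icc (0 : ℝ) 1, (Polynomial.aeval s u + β) * b ≤ 1)
    (hvan : ∀ ϖ ∈ Ioo 0 b, ∫ z in Set.pi Set.univ (fun _ : Fin 2 => Ioo (0 : ℝ) 1),
      aeval z P / (1 - ϖ * (Polynomial.aeval (z 1) u + β * z 0)) = 0) :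
    ∀ g : Polynomial ℝ, ∫ z in Set.pi Set.univ (fun _ : Fin 2 => Ioo (0 : ℝ) 1),
      g.eval (Polynomial.aeval (z 1) u + β * z 0) * aeval z P = 0 := by
  intro g
  -- each term `g_i · (P T^i)` is continuous on the compact closed square, hence integrable
  have hint : ∀ i : ℕ, Integrable (fun z : Fin 2 → ℝ =>
      g.coeff i * (aeval z P * (Polynomial.aeval (z 1) u + (β : ℝ) * z 0) ^ i))
      (volume.restrict (Set.pi Set.univ (fun _ : Fin 2 => Ioo (0 : ℝ) 1))) := fun i =>
    ((continuous_const.mul ((LinMoments.continuous_aeval P).mul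
      ((GpMoments.continuous_gpT u β).pow i))).integrableOn_Icc.mono_set
        LinMoments.sq_subset_Icc)
  -- `g(T)·P = Σ_i g_i (P T^i)`
  have heq :
      (fun z : Fin 2 → ℝ => g.eval (Polynomial.aeval (z 1) u + (β : ℝ) * z 0) * aeval z P) =
        fun z => ∑ i ∈ Finset.range (g.natDegree + 1),
        g.coeff i * (aeval z P * (Polynomial.aeval (z 1) u + (β : ℝ) * z 0) ^ i) := by
    funext z
    rw [Polynomial.eval_eq_sum_range, Finset.sum_mul]
    refine Finset.sum_congr rfl fun i _ => ?_
    ring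
  rw [heq, integral_finsetSum _ fun i _ => hint i]
  refine Finset.sum_eq_zero fun i _ => ?_
  rw [integral_const_mul, GpMoments.moment_eq_zero hβ hb hu0 hub hvan i, mul_zero]

end Summit.KontsevichZagierPeriods.InverseLandau.TateFamilyKernel.Descent
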